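/-
Copyright (c) 2026 the pub-hodgecm-mathlib formalisation cell (harness21).  Prover seat hodgecm-mathlib-F0P2-p09 (g2), Track B «K2-LIT»,
#184♮ = hLiu418 = `stmt-HodgeConjecture-24832`; socket #41, KIND 1 (K1-b♮), brick (ρ6b) of K2Liu-p14 (g4)'s K1b∕ρ DESK WORD #4 — LEAD F0P6-plan (g14) BATCH #159.
THEOREMS ONLY (no `def`, no `instance`, no notation, no named-fact hypothesis, no `sorry`).
-/
import Mathlib.NumberTheory.Height.NumberField
import Mathlib.NumberTheory.NumberField.CanonicalEmbedding.Basic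
import Mathlib.Data.Matrix.Mul
import HarnessLib

/-!
# Crux `HLiu418`, socket #41, KIND 1, brick (ρ6b): THE PROJECTIVE HEIGHT OF THE LINE OF A RANK-ONE INDEX — `H([w]) ≤ (D·(1 + τ(S)))^{[L:ℚ]}` for `S = u ⊗ w ≠ 0` with `D·S`
# integral and `τ(S) = ‖(mixedEmbedding L (S i j))_{ij}‖`

Cell `hodgecm-mathlib`, crux item hLiu418 = `stmt-HodgeConjecture-24832` (helper lane `--supports … --as helper`, count-neutral), route of record `HCCMUnconditional`;
squad K2 ∕ K2Liu (L1, LEAD F0P6-plan (g14)), road `K2_Liu`, socket #41 `sig_K2LiuSiegelEisensteinContinuation`, KIND 1, organ (K1b-♮) (desk K2Liu-p14 (g4)): the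
decay letter `hdecb` of ★ `K2LiuKindOneLineTermPackage` (K2Liu-p14's (P-dec) `K2LiuKindOneLineDecay`) sees the rank-one index `S = u ⊗ w` through the Levi element `Λγ[w]`
polynomially in the height of `γ[w]`; (ρ6a) (`K2LiuRowSectionProjectiveHeight`, R90-C10-p03) bounds that height by the PROJECTIVE height of the line `[w]`, and THIS FILE bounds
the projective height of `[w]` by the denominator `D` of `S` (`hsuppb`: `D·S` integral, `1 ≤ D ≤ C_b·H(h)^{κ_b}`) and the archimedean size `τ(S)` — so every polynomial factor
becomes `C·H(h)^{A′}·(1 + τ_b S)^{N′}`, the TOP's shape.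
CURRENCY.  The projective height is Mathlib's `Height.mulHeight (x : ι → L)` (`Mathlib.NumberTheory.Height.*`; number fields: `NumberField.mulHeight_eq`:
`H(x) = ∏_{v∣∞} (max_i |x_i|_v)^{mult v} · ∏ᶠ_{v∤∞} max_i |x_i|_v`; scale-invariant `Height.mulHeight_smul_eq_mulHeight`; `= Projectivization.mulHeight [x]`).
THE MATHEMATICS ([BombieriGubler2006, §1.5], [HindrySilverman2000, B.2]).  `S = u ⊗ w ≠ 0` (`vecMulVec u w`) has a row `S_{i₀•} = u_{i₀}·w` with `u_{i₀} ≠ 0`, so `H([w]) =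
H(S_{i₀•}) = H(D·S_{i₀•})` (scale invariance twice); the tuple `D·S_{i₀•}` has INTEGRAL entries, so every non-archimedean factor is `≤ 1`, and every archimedean entry is
`|D·S_{i₀j}|_v = D·|S_{i₀j}|_v ≤ D·‖mixedEmbedding L (S_{i₀j})‖ ≤ D·τ(S)`; hence `H([w]) ≤ ∏_{v∣∞} (D(1+τ))^{mult v} = (D(1+τ))^{Σ mult} = (D(1+τ))^{[L:ℚ]}` (Mathlib
`InfinitePlace.sum_mult_eq`).
* §1 `apply_le_norm_mixedEmbedding` (`|x|_v ≤ ‖mixedEmbedding L x‖`), `finitePlace_apply_le_one_of_isIntegral`, **`mulHeight_le_pow_of_isIntegral`** (an integral non-zero tuple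
  with all archimedean entries `≤ B` has `H ≤ B^{[L:ℚ]}`).
* §2 **`mulHeight_le_of_vecMulVec_integral`** — the (ρ6b) head.
HONEST LABEL.  Count-neutral helper; closes no socket by itself; `HC_CM` is proved only modulo the 7 printed citations (2 remaining named inputs:
hLiu418 = `stmt-HodgeConjecture-24832`, h413 = `stmt-HodgeConjecture-24833`) until rung 0 closes.

## References
* [BombieriGubler2006] E. Bombieri, W. Gubler, *Heights in Diophantine Geometry* (2006): §1.5 (the projective height; product formula; integral coordinates).
* [HindrySilverman2000] M. Hindry, J. Silverman, *Diophantine Geometry* (2000): B.2 (heights of points with integral coordinates).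
-/

set_option autoImplicit false
-- the mandated namespace repeats the single-problem summit's segment (`HodgeConjecture.HodgeConjecture`)
set_option linter.dupNamespace false

noncomputable section

open scoped Classical
open NumberField NumberField.InfinitePlace NumberField.mixedEmbedding Height

namespace Summit.HodgeConjecture.HodgeConjecture.Cruxes.HLiu418.K2LiuRankOneLineProjectiveHeight

variable (L : Type*) [Field L] [NumberField L]

/-! ## §1 Archimedean entries under the mixed embedding; integral tuples -/

/-- `|x|_v ≤ ‖mixedEmbedding L x‖` for every infinite place `v` (the mixed-space norm is the sup of the `normAtPlace`). [cite: BombieriGubler2006, §1.5] -/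
theorem apply_le_norm_mixedEmbedding (v : InfinitePlace L) (x : L) : v x ≤ ‖mixedEmbedding L x‖ := by
  classical
  rw [norm_eq_sup'_normAtPlace, ← normAtPlace_apply v x]
  exact Finset.le_sup' (fun w => normAtPlace w (mixedEmbedding L x)) (Finset.mem_univ v)

/-- a finite place is `≤ 1` on an algebraic integer. [cite: BombieriGubler2006, §1.5] -/
theorem finitePlace_apply_le_one_of_isIntegral (w : FinitePlace L) {x : L} (hx : IsIntegral ℤ x) : w x ≤ 1 := by
  have h := FinitePlace.norm_le_one L w.maximalIdeal (⟨x, (mem_integralClosure_iff ℤ L).2 hx⟩ : 𝓞 L)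
  rwa [FinitePlace.norm_embedding_eq] at h

/-- **AN INTEGRAL TUPLE WITH ARCHIMEDEAN ENTRIES `≤ B` HAS HEIGHT `≤ B^{[L:ℚ]}`**: for `x : ι → L` non-zero with `IsIntegral ℤ (x i)` for all `i` and `|x_i|_v ≤ B` at every infinite
place, `mulHeight x ≤ B ^ finrank ℚ L` (finite factors `≤ 1`; `∏_v B^{mult v} = B^{Σ mult}`, ★ Mathlib `InfinitePlace.sum_mult_eq`).
[cite: BombieriGubler2006, §1.5] [cite: HindrySilverman2000, B.2] -/
theorem mulHeight_le_pow_of_isIntegral {ι : Type*} [Fintype ι] (x : ι → L) (hx : x ≠ 0) (hint : ∀ i, IsIntegral ℤ (x i))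
    {B : ℝ} (hB : ∀ (v : InfinitePlace L) (i : ι), v (x i) ≤ B) :
    mulHeight x ≤ B ^ Module.finrank ℚ L := by
  haveI : Nonempty ι := (Function.ne_iff.mp hx).nonempty
  have hB0 : 0 ≤ B := by
    obtain ⟨i⟩ := (inferInstance : Nonempty ι)
    obtain ⟨v⟩ := (inferInstance : Nonempty (InfinitePlace L))
    exact (apply_nonneg v (x i)).trans (hB v i)
  rw [NumberField.mulHeight_eq hx]
  -- the finite part is `≤ 1`
  have hfin : (∏ᶠ w : FinitePlace L, ⨆ i, w (x i)) ≤ 1 := by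
    refine (finprod_induction (fun t : ℝ => 0 ≤ t ∧ t ≤ 1) ⟨zero_le_one, le_rfl⟩ (fun a b ha hb => ⟨mul_nonneg ha.1 hb.1, mul_le_one₀ ha.2 hb.1 hb.2⟩)
      fun w => ⟨?_, ?_⟩).2
    · exact Real.iSup_nonneg fun i => apply_nonneg w (x i)
    · exact ciSup_le fun i => finitePlace_apply_le_one_of_isIntegral L w (hint i)
  -- the archimedean part
  have hinf : (∏ v : InfinitePlace L, (⨆ i, v (x i)) ^ v.mult) ≤ ∏ v : InfinitePlace L, B ^ v.mult := by
    refine Finset.prod_le_prod (fun v _ => pow_nonneg (Real.iSup_nonneg fun i => apply_nonneg v (x i)) _) fun v _ => ?_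
    exact pow_le_pow_left₀ (Real.iSup_nonneg fun i => apply_nonneg v (x i)) (ciSup_le fun i => hB v i) _
  have hinf0 : 0 ≤ ∏ v : InfinitePlace L, (⨆ i, v (x i)) ^ v.mult :=
    Finset.prod_nonneg fun v _ => pow_nonneg (Real.iSup_nonneg fun i => apply_nonneg v (x i)) _
  calc (∏ v : InfinitePlace L, (⨆ i, v (x i)) ^ v.mult) * ∏ᶠ w : FinitePlace L, ⨆ i, w (x i)
      ≤ (∏ v : InfinitePlace L, B ^ v.mult) * 1 := mul_le_mul hinf hfin (finprod_nonneg fun w => Real.iSup_nonneg fun i => apply_nonneg w (x i))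
          ((Finset.prod_nonneg fun v _ => pow_nonneg hB0 _))
    _ = B ^ Module.finrank ℚ L := by rw [mul_one, Finset.prod_pow_eq_pow_sum, InfinitePlace.sum_mult_eq]

/-! ## §2 The projective height of the line of a rank-one index -/

/-- **(ρ6b) THE PROJECTIVE HEIGHT OF THE LINE `[w]` OF A RANK-ONE INDEX `S = u ⊗ w`**: if `S = vecMulVec u w ≠ 0` and `D·S` has integral entries for some `D ≥ 1` (the conclusion of
the support letter `hsuppb`), then **`mulHeight w ≤ (D · (1 + τ(S)))^{[L:ℚ]}`** with `τ(S) = ‖fun i j => mixedEmbedding L (S i j)‖` (the TOP's archimedean majorant norm) —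
`C′ = 1`, `k′ = [L:ℚ]`.  (A row `S_{i₀•} = u_{i₀}·w`, `u_{i₀} ≠ 0`, so `H(w) = H(S_{i₀•}) = H(D·S_{i₀•})` by scale invariance, and `D·S_{i₀•}` is integral with archimedean entries
`≤ D·τ(S)`.) [cite: BombieriGubler2006, §1.5] [cite: HindrySilverman2000, B.2] -/
theorem mulHeight_le_of_vecMulVec_integral {m k : Type*} [Fintype m] [Fintype k] (u : m → L) (w : k → L) (hS : Matrix.vecMulVec u w ≠ 0)
    {D : ℕ} (hD : 1 ≤ D) (hint : ∀ i j, IsIntegral ℤ ((D : L) * Matrix.vecMulVec u w i j)) :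
    mulHeight w ≤ ((D : ℝ) * (1 + ‖fun i j => mixedEmbedding L (Matrix.vecMulVec u w i j)‖)) ^ Module.finrank ℚ L := by
  classical
  -- a row with `u i₀ ≠ 0`
  obtain ⟨i₀, hi₀⟩ : ∃ i₀, u i₀ ≠ 0 := by
    by_contra h
    push Not at h
    exact hS (Matrix.ext fun i j => by rw [Matrix.vecMulVec_apply, h i, zero_mul, Matrix.zero_apply])
  have hw : w ≠ 0 := by
    rintro rfl
    exact hS (Matrix.ext fun i j => by rw [Matrix.vecMulVec_apply, Pi.zero_apply, mul_zero, Matrix.zero_apply])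
  have hD0 : (D : L) ≠ 0 := Nat.cast_ne_zero.2 (by omega)
  -- the integral tuple `x := D • (u i₀ • w) = (D·S)_{i₀•}`
  set x : k → L := fun j => (D : L) * Matrix.vecMulVec u w i₀ j with hxdef
  have hxw : x = ((D : L) * u i₀) • w := by
    funext j
    show (D : L) * Matrix.vecMulVec u w i₀ j = ((D : L) * u i₀) * w j
    rw [Matrix.vecMulVec_apply, mul_assoc]
  have hx0 : x ≠ 0 := by
    rw [hxw]
    exact smul_ne_zero (mul_ne_zero hD0 hi₀) hw
  have hHeq : mulHeight w = mulHeight x := by rw [hxw, mulHeight_smul_eq_mulHeight w (mul_ne_zero hD0 hi₀)]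
  rw [hHeq]
  refine mulHeight_le_pow_of_isIntegral L x hx0 (fun j => hint i₀ j) fun v j => ?_
  -- archimedean entries: `|D·S_{i₀ j}|_v = D·|S_{i₀ j}|_v ≤ D·‖mixedEmbedding (S i₀ j)‖ ≤ D·τ ≤ D·(1+τ)`
  have hτ : ‖mixedEmbedding L (Matrix.vecMulVec u w i₀ j)‖ ≤ ‖fun i j => mixedEmbedding L (Matrix.vecMulVec u w i j)‖ :=
    (norm_le_pi_norm (fun j' => mixedEmbedding L (Matrix.vecMulVec u w i₀ j')) j).trans
      (norm_le_pi_norm (fun i j => mixedEmbedding L (Matrix.vecMulVec u w i j)) i₀)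
  have hvD : v (D : L) = D := by rw [← InfinitePlace.norm_embedding_eq, map_natCast, Complex.norm_natCast]
  show v ((D : L) * Matrix.vecMulVec u w i₀ j) ≤ _
  rw [map_mul, hvD]
  refine mul_le_mul_of_nonneg_left ?_ (Nat.cast_nonneg D)
  exact ((apply_le_norm_mixedEmbedding L v _).trans hτ).trans (le_add_of_nonneg_left zero_le_one)

end Summit.HodgeConjecture.HodgeConjecture.Cruxes.HLiu418.K2LiuRankOneLineProjectiveHeight

end
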